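import Summits.QuantumFields.YangMills.Theorems.BalabanUVNodesRateCarriersOfRecord13CoPH

/-!
# BalabanUVNodes ∕ N19 — THE (v′-17) RUN LETTERS AND THE PINNED SIDE LETTERS OF THE N19′ LINK READING `hlink`, INHABITED AT THE STAGE-13
# `CoPH` RECORD BUNDLE `rateCarriersOfRecord₁₃CoPH 𝔯 F θ hP g₀ os k` FROM A TUNED BARE SEQUENCE (the `ForSmallCouplings` prefix)

Cell `pub-ymgap` (HUMAN RULING D-0062, Track A; director-ym №197 ∕ HUMAN RULING D-0149 work-bound push), node N19 = NE7, WIDTH SEAT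
`pub-ymgap-dag-n19-w3` (g0).  Item of record: plan g77 `W-SEAT-START-LIST.md` v3 §2 n19, w3 — «inhabit the NON-NODE-O displayed conjuncts of
`hlink` at the guarded admissible ₁₃ record tuples … name the conjuncts you take» (CLAIM line pub-ymgap INBOX l.24190).  Filed
`--kind proof --supports stmt-QuantumFields-20544 --as helper` (K3⁷ `SpineGivenEndpointR13SepCoPH`).  COUNT-NEUTRAL.  THEOREMS ONLY (0 `def`,
0 `sorry`, standard axioms); imports ONE module (dag-n22-e's v1.7 rate-record home `BalabanUVNodesRateCarriersOfRecord13CoPH`, p541030, which brings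
`Spine/NE4/Targets` and `T4TwoRunUniqueness`); edits nothing; no Theses import.

THE SITUATION.  The N19′ rate edge of record reads, per `(F, D, g₀, os, S, R)`, a LINK READING `hlink` = one existential over letters with ≈ 100
displayed conjuncts (dag-n19-c v9 `N19RateEdgeTubeC1.rateEdge_of_linkReading_byName_pairDiscC1`, p475545; dag-n19-d E `N19RateEdgeHolder` p582895 ports it to the
R-β currency and F `N19RateEdgeHolderAtRecord13CoPH.h19Holder_datumOfRecord₁₃CoPH_of_linkReading` p583345 DISPLAYS it at the ₁₃ record tuples — v9's ∃-clause
VERBATIM under `let S := cr F θ hP g₀ os; let R := rateCarriersOfRecord₁₃CoPH 𝔯 F θ hP g₀ os k; let D := datumOfRecord₁₃CoPH F N θ hP` — pub-ymgap INBOX l.24019 ∕ l.24155).  Among its conjuncts, clause (v′-17) «N17 BY NAME» carries RUN LETTERS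
`g : ℕ → ℕ → ℝ`, `gIR : ℝ` and a first-coupling selector `bsel : (ℕ → ℝ) → ℝ` subject to
* the (0.20)-run identification `∀ K, RGEqH K D.βfun (g K)` and the infrared pin `∀ K, g K K = gIR`,
* the box `∀ K i, i ≤ K → 0 < g K i ∧ g K i ≤ R.u3.γ`,
* the window memberships `∀ K, g K ∈ R.u3.W` and `∀ K, (fun i => g (K + 1) (i + 1)) ∈ R.u3.W` (read by the bracket (T)'s `DecayBound` at `s := g K`),
* the selector clause `∀ s ∈ R.u3.W, 0 < bsel s ∧ bsel s ≤ R.u3.γ` (run B's functional `EB := fun s => R.u3.EB (bsel s) s`),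
the bracket (T)'s run clause «UPPER running of the tables» `∀ K j, j ≤ K → 1∕(g K j)² ≤ 1∕gIR² + β′_T·(K − j)` with `0 ≤ β′_T` ((2.6) ∕ (0.31) upper half),
and clause (v′-16) «N16 BY NAME» carries the block-factor letters `2 ≤ R.ne3.L`, `0 < θ ∧ θ ^ 6 = (R.ne3.L)⁻¹`; the letter signs
`0 ≤ R.u3.θ ∧ 0 ≤ R.u3.C₅ ∧ 0 ≤ R.u3.ω` sit between them, and the bracket (T) asks the window clause `∀ s ∈ R.u3.W, ∀ j, 0 < s j ∧ s j ^ 2 ≤ e⁻¹`.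
AT THE ₁₃ RECORD BUNDLE `R := rateCarriersOfRecord₁₃CoPH 𝔯 F θ hP g₀ os k` on the datum of record `D := datumOfRecord₁₃CoPH F N θ hP` these letters
are NOT NODE O's and NOT residual: `R.u3.W = Window θ.γ`, `R.u3.γ = θ.γ`, `R.ne3.L = F.L` hold by `rfl` (§1 of the home), and the runs of record
are `Spine.NE4.runFlow D g₀ K = (D.C ⟨K, F.m, g₀ K⟩).flow.g`.  This file INHABITS them:

* §1 `rgEqH_congr` — (0.20) up to `K` only reads the couplings `g_0, …, g_K` ([folklore]);
  ★ **`runLetters_of_tuned`** (generic datum `D : Datum F N`) — for a bare sequence TUNED to `gIR` within `]0, γ]` (`D.Tuned γ gIR g₀`, the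
  renormalisation condition of [Balaban1987RG1] Thm 2 p. 259 = the `ForSmallCouplings` prefix of the crux's extraction clause `hx`) and the
  printed-type upper bound `BetaUpperH β′ γ D.βfun` with `γ²β′ < 1` (p. 264; only to run (0.20) forward — `T4TwoRunUniqueness.rgEqH_of_tuned`
  BY NAME), the WINDOW-EXTENDED runs `g K i := runFlow D g₀ K i (i ≤ K), := gIR (i > K)` satisfy ALL SIX run clauses at ANY window radius
  `γ′ ≥ γ` AND the bracket (T)'s UPPER RUNNING `1∕g_j² ≤ 1∕gIR² + β′_T·(K − j)` with `β′_T := max β′ 0` (`invSq_le_of_rgEqH_betaUpperH`,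
  telescoped (0.20)), with `bsel := fun _ => gIR`, `0 < gIR ≤ γ`, and agree with `runFlow` up to the cutoff.  (The raw `runFlow D g₀ K` is unconstrained
  past `i = K`, so v9's `hgA ∕ hgB` — membership in `Window` at EVERY index — is not available for it; the extension is the content-free repair.)
* §2 ★ **`runLetters_rateCarriersOfRecord₁₃CoPH_of_tuned`** — the same DISPLAYED AT THE ₁₃ RECORD: for every Stage-13 tuple `θ` with provisos `hP`,
  every run length `k`, the six clauses + the upper running hold with `R.u3.W`, `R.u3.γ`, `(datumOfRecord₁₃CoPH F N θ hP).βfun` LITERALLY as v9 ∕ INTENT-F display them,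
  given tuning within `]0, γ]`, `γ ≤ θ.γ`; `runLetters_rateCarriersOfRecord₁₃CoPH_of_tuned_self` (the case `γ = θ.γ`);
  **`forSmallCouplings_runLetters_datumOfRecord₁₃CoPH`** — under the crux's prefix: with the upper bound on ONE box `]0, γᵤ]`, the run letters exist
  for EVERY `γ ≤ min γᵤ θ.γ`, every `gIR`, every tuned `g₀` (threshold `γ₀ := min γᵤ θ.γ`; `ForSmallCouplings` BY NAME).
* §3 `two_le_ne3_L_rateCarriersOfRecord₁₃CoPH`, `exists_theta6_rateCarriersOfRecord₁₃CoPH`, ★ `ne3Letters_rateCarriersOfRecord₁₃CoPH` — the (v′-16)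
  block-factor letters at the record (`θ := (F.L)^{−1∕6}`, `Real.rpow`).
* §4 `signs_of_readOutAt` — the letter signs (and `θ ≤ ρ`, `ω ≤ ρ`, `0 ≤ cr`) from the (D4) read-out binders `ReadOutAt D u` (K3⁷ v2 DRAFT's
  `PHolderD4 β D R := RatesHolderAt D R β ∧ ReadOutAt D R.u3` second conjunct); `signs_rateCarriersOfRecord₁₃CoPH_of_readOutAt` at the record.
* §5 `window_sq_le_exp_neg_one`, `window_rateCarriersOfRecord₁₃CoPH_sq_le_exp_neg_one` — (T)'s window clause from the displayed `θ.γ ^ 2 ≤ e⁻¹`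
  (admissibility gives `0 < θ.γ < 1` only; the numerical clause stays a displayed letter of the tuple).
* §6 `gamma_pos_rateCarriersOfRecord₁₃CoPH` — `0 < R.u3.γ` at an admissible tuple (`Stage9Params.Admissible.gamma_pos`).

NOT TAKEN HERE (named in the CLAIM line so that siblings see the map): the ledger predicate (i), the lattice identification (ii-m) against NODE O's
reference ledger `L.All`, [III] Thm 2 (2.43) `B14.Thm2Printed` (N11), N14's positional count on `𝔯.ne1` (iv), (ii-v-A∕B), (ii-d), the gauge-domination
convention `hdomC1`, `LeafH3sup` ∕ the minimiser selection (N07 ∕ N16 letters of `𝔯.lit`), `EventualLowerH` and node U2's smallness window (β-side,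
N25 ∕ B3), the bracket (T)'s `DecayBound` ∕ pair discs on `R.u3.EA` — NODE O's objects, other nodes' statements, or letters of the RESIDUAL reading `𝔯`.

HONEST FRAMING.  Count-neutral kernel bookkeeping: one-line knits over landed run lemmas (`rgEqH_of_tuned`, `box_and_pin_of_tuned`) plus an index split,
`rfl` faces of the record bundle, sign projections, `Real.rpow` arithmetic.  `D.Tuned γ gIR g₀` and `BetaUpperH β′ γ D.βfun` are HYPOTHESES (the first is
K2⁷'s ∕ [B12] Thm 2's content at the datum of record, the second the printed p. 264 bound whose proof print defers) — nothing of Bałaban's is asserted or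
instantiated; no inhabitant of `Provisos₁₃CoPH` is claimed (K0⁷ OPEN); NE7 NOT PRINTED for d = 4 and NOT PROVED; N19 NOT discharged; K3⁷ NOT claimed; counts
UNMOVED (typed 28∕28 · discharged 5∕27 · A 5∕28).  One finite four-torus programme at fixed `ε`, Bałaban as printed — R4 closes the CONDITIONAL finite-𝕋⁴ rung
`BalabanLadder.UV` only; NOT continuum ∕ ℝ⁴ ∕ infinite volume ∕ OS; the YM mass gap (Clay) is NOT proved by any of this.  No decl below carries a cite tag.
-/

noncomputable section

namespace Summit.QuantumFields.YangMills.BalabanUVNodes.N19RateEdgeRecordRunLetters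

open Literature.MathematicalPhysics.QuantumFieldTheory.Balaban1983to89
open Literature.MathematicalPhysics.QuantumFieldTheory.Balaban1983to89.T4Continuum
open Literature.MathematicalPhysics.QuantumFieldTheory.Balaban1983to89.FlowStep (HBeta RGEqH BetaUpperH prefixOf)
open Literature.MathematicalPhysics.QuantumFieldTheory.Balaban1983to89.T4OutputRate (Window)
open Literature.MathematicalPhysics.QuantumFieldTheory.Balaban1983to89.T4TwoRunUniqueness (rgEqH_of_tuned)
open Literature.MathematicalPhysics.QuantumFieldTheory.Balaban1983to89.T4ContinuumYM4Torus (ForSmallCouplings)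
open Summit.QuantumFields.BalabanUV.T4Continuum.Spine.NE4 (runFlow box_and_pin_of_tuned)
open YMDAG.UVSplit
open Node00 (Stage13HParams datumOfRecord₁₃CoPH)

variable {F : T4Family} {N : ℕ} [NeZero N]

/-! ## §1 Window-extended runs of a tuned bare sequence (generic datum) -/

/-- The history recursion (0.20) up to `K` reads only the couplings `g_0, …, g_K`: two sequences agreeing there solve it together. [folklore] -/
theorem rgEqH_congr {K : ℕ} {β : HBeta} {g g' : ℕ → ℝ} (h : RGEqH K β g) (heq : ∀ i, i ≤ K → g' i = g i) : RGEqH K β g' := by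
  intro k hk
  have hpre : prefixOf g' k = prefixOf g k := by
    funext i
    simp only [FlowStep.prefixOf_apply]
    exact heq i ((Nat.lt_succ_iff.mp i.isLt).trans hk.le)
  rw [heq k hk.le, heq (k + 1) hk, hpre]
  exact h k hk

/-- **THE UPPER RUNNING OF THE TABLES** along one solution of (0.20) in the box `]0, γ]^{K+1}` under the printed-type upper bound `β ≤ β′` on the
γ-boxes ([Balaban1987RG1] p. 264): `1∕g_j² ≤ 1∕g_K² + max(β′,0)·(K − j)` for `j ≤ K` (telescoped (0.20), `FlowStep.inv_sq_telescopeH`; the bracket (T)'s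
«upper half of (2.6) ∕ (0.31)» clause of `hlink` with `β′_T := max β′ 0`). [folklore] -/
theorem invSq_le_of_rgEqH_betaUpperH {K : ℕ} {β : HBeta} {r : ℕ → ℝ} {β' γ : ℝ} (hrg : RGEqH K β r)
    (hI : ∀ i, i ≤ K → 0 < r i ∧ r i ≤ γ) (hup : BetaUpperH β' γ β) {j : ℕ} (hj : j ≤ K) :
    1 / r j ^ 2 ≤ 1 / r K ^ 2 + max β' 0 * ((K : ℝ) - j) := by
  have ht := FlowStep.inv_sq_telescopeH hrg hj le_rfl
  have hsum : ∑ i ∈ Finset.Ico j K, β i (prefixOf r i) ≤ ∑ _i ∈ Finset.Ico j K, max β' 0 := by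
    refine Finset.sum_le_sum fun i hi => ?_
    have hiK : i < K := (Finset.mem_Ico.mp hi).2
    exact (hup i _ (FlowStep.mem_box.mpr fun l => hI l ((Nat.lt_succ_iff.mp l.isLt).trans hiK.le))).trans
      (le_max_left _ _)
  rw [Finset.sum_const, Nat.card_Ico, nsmul_eq_mul, Nat.cast_sub hj] at hsum
  rw [ht]
  linarith

/-- **THE (v′-17) RUN LETTERS FROM TUNING** [bookkeeping].  For a datum `D`, a bare sequence `g₀` TUNED to `gIR` within `]0, γ]` and the printed-type
upper bound `BetaUpperH β′ γ D.βfun` with `γ²β′ < 1`, the WINDOW-EXTENDED runs of record — `runFlow D g₀ K i` up to the cutoff `i ≤ K`, the infrared value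
`gIR` beyond — satisfy, at ANY window radius `γ′ ≥ γ`: the (0.20)-run identification (`rgEqH_of_tuned` + `rgEqH_congr`), the infrared pin, the box, BOTH window
memberships (the run and the shifted longer run, at EVERY index), the selector clause with `bsel := fun _ => gIR`, the bracket (T)'s upper running with
`β′_T := max β′ 0 ≥ 0`, `0 < gIR ≤ γ`, and agreement with `runFlow` up to the cutoff.  NOT NE4 ∕ NE7; nothing of Bałaban's asserted. -/
theorem runLetters_of_tuned (D : Datum F N) {β' γ gIR γ' : ℝ} {g₀ : ℕ → ℝ}
    (hhi : BetaUpperH β' γ D.βfun) (hγβ : γ ^ 2 * β' < 1) (hγ : 0 < γ) (ht : D.Tuned γ gIR g₀) (hγle : γ ≤ γ') :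
    ∃ (g : ℕ → ℕ → ℝ) (bsel : (ℕ → ℝ) → ℝ),
      (∀ K, RGEqH K D.βfun (g K)) ∧ (∀ K, g K K = gIR) ∧
      (∀ K i, i ≤ K → 0 < g K i ∧ g K i ≤ γ') ∧
      (∀ K, g K ∈ Window γ') ∧ (∀ K, (fun i => g (K + 1) (i + 1)) ∈ Window γ') ∧
      (∀ s ∈ Window γ', 0 < bsel s ∧ bsel s ≤ γ') ∧
      (∀ K j, j ≤ K → 1 / g K j ^ 2 ≤ 1 / gIR ^ 2 + max β' 0 * ((K : ℝ) - j)) ∧ 0 < gIR ∧ gIR ≤ γ ∧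
      (∀ K i, i ≤ K → g K i = runFlow D g₀ K i) := by
  obtain ⟨hbox, hpin⟩ := box_and_pin_of_tuned D ht
  have hIR : 0 < gIR ∧ gIR ≤ γ := by
    have h := hbox 0 0 le_rfl
    rwa [hpin 0] at h
  -- the window-extended runs
  refine ⟨fun K i => if i ≤ K then runFlow D g₀ K i else gIR, fun _ => gIR, ?_, ?_, ?_, ?_, ?_, ?_, ?_, hIR.1, hIR.2, ?_⟩
  · -- (0.20) up to `K`: the extension agrees with `runFlow` there
    intro K
    exact rgEqH_congr (rgEqH_of_tuned D hhi hγβ hγ le_rfl ht K) fun i hi => by simp only [if_pos hi]; rfl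
  · -- the infrared pin
    intro K
    simp only [if_pos le_rfl]
    exact hpin K
  · -- the box, worsened to `γ′`
    intro K i hi
    simp only [if_pos hi]
    exact ⟨(hbox K i hi).1, (hbox K i hi).2.trans hγle⟩
  · -- window membership of the run at EVERY index
    intro K i
    by_cases hi : i ≤ K
    · simp only [if_pos hi]
      exact ⟨(hbox K i hi).1, (hbox K i hi).2.trans hγle⟩
    · simp only [if_neg hi]
      exact ⟨hIR.1, hIR.2.trans hγle⟩
  · -- window membership of the shifted longer run at EVERY index
    intro K i
    by_cases hi : i + 1 ≤ K + 1
    · simp only [if_pos hi]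
      exact ⟨(hbox (K + 1) (i + 1) hi).1, (hbox (K + 1) (i + 1) hi).2.trans hγle⟩
    · simp only [if_neg hi]
      exact ⟨hIR.1, hIR.2.trans hγle⟩
  · -- the selector clause
    intro s _
    exact ⟨hIR.1, hIR.2.trans hγle⟩
  · -- the upper running of the tables along the cutoff-`K` run, read at the extension (agreement up to `K`) and the pin
    intro K j hj
    have h := invSq_le_of_rgEqH_betaUpperH (r := runFlow D g₀ K) (rgEqH_of_tuned D hhi hγβ hγ le_rfl ht K) (hbox K) hhi hj
    rw [hpin K] at h
    simpa only [if_pos hj] using h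
  · -- agreement with `runFlow` up to the cutoff
    intro K i hi
    simp only [if_pos hi]

/-! ## §2 The run letters DISPLAYED AT THE ₁₃ RECORD BUNDLE -/

section AtRecord

variable (𝔯 : RateReading₁₃CoPH N) (θ : Stage13HParams F N) (hP : θ.Provisos₁₃CoPH F N)

/-- The record bundle's window IS `Window θ.γ` and its radius IS `θ.γ` (`rfl`, the home's §1 faces read at `θ.toStage13Params`). [bookkeeping] -/
theorem window_rateCarriersOfRecord₁₃CoPH (g₀ : ℕ → ℝ) (os : List (ULoop F)) (k : ℕ) :
    (rateCarriersOfRecord₁₃CoPH 𝔯 F θ hP g₀ os k).u3.W = Window θ.γ ∧ (rateCarriersOfRecord₁₃CoPH 𝔯 F θ hP g₀ os k).u3.γ = θ.γ :=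
  ⟨rfl, rfl⟩

/-- **THE (v′-17) RUN LETTERS AT THE ₁₃ RECORD BUNDLE** [bookkeeping]: for a bare sequence tuned to `gIR` within `]0, γ]`, `γ ≤ θ.γ`, on the datum of record
`datumOfRecord₁₃CoPH F N θ hP`, and the printed-type upper bound with `γ²β′ < 1`, the six run clauses of `hlink` and (T)'s upper running hold with `R.u3.W`, `R.u3.γ`, `D.βfun` read
LITERALLY at `R := rateCarriersOfRecord₁₃CoPH 𝔯 F θ hP g₀ os k`, for EVERY loop string `os` and run length `k` (the clauses do not read `𝔯`: `R.u3.W = Window θ.γ`,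
`R.u3.γ = θ.γ` by `rfl`).  One application of `runLetters_of_tuned` at `γ′ := θ.γ`. -/
theorem runLetters_rateCarriersOfRecord₁₃CoPH_of_tuned {β' γ gIR : ℝ} {g₀ : ℕ → ℝ}
    (hhi : BetaUpperH β' γ (datumOfRecord₁₃CoPH F N θ hP).βfun) (hγβ : γ ^ 2 * β' < 1) (hγ : 0 < γ)
    (ht : (datumOfRecord₁₃CoPH F N θ hP).Tuned γ gIR g₀) (hγle : γ ≤ θ.γ) (os : List (ULoop F)) (k : ℕ) :
    ∃ (g : ℕ → ℕ → ℝ) (bsel : (ℕ → ℝ) → ℝ),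
      (∀ K, RGEqH K (datumOfRecord₁₃CoPH F N θ hP).βfun (g K)) ∧ (∀ K, g K K = gIR) ∧
      (∀ K i, i ≤ K → 0 < g K i ∧ g K i ≤ (rateCarriersOfRecord₁₃CoPH 𝔯 F θ hP g₀ os k).u3.γ) ∧
      (∀ K, g K ∈ (rateCarriersOfRecord₁₃CoPH 𝔯 F θ hP g₀ os k).u3.W) ∧
      (∀ K, (fun i => g (K + 1) (i + 1)) ∈ (rateCarriersOfRecord₁₃CoPH 𝔯 F θ hP g₀ os k).u3.W) ∧
      (∀ s ∈ (rateCarriersOfRecord₁₃CoPH 𝔯 F θ hP g₀ os k).u3.W,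
        0 < bsel s ∧ bsel s ≤ (rateCarriersOfRecord₁₃CoPH 𝔯 F θ hP g₀ os k).u3.γ) ∧
      (∀ K j, j ≤ K → 1 / g K j ^ 2 ≤ 1 / gIR ^ 2 + max β' 0 * ((K : ℝ) - j)) ∧
      0 < gIR ∧ gIR ≤ γ ∧ (∀ K i, i ≤ K → g K i = runFlow (datumOfRecord₁₃CoPH F N θ hP) g₀ K i) :=
  runLetters_of_tuned (datumOfRecord₁₃CoPH F N θ hP) hhi hγβ hγ ht hγle

/-- The case `γ = θ.γ`: tuning within the record's OWN window `]0, θ.γ]`. [bookkeeping] -/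
theorem runLetters_rateCarriersOfRecord₁₃CoPH_of_tuned_self {β' gIR : ℝ} {g₀ : ℕ → ℝ}
    (hhi : BetaUpperH β' θ.γ (datumOfRecord₁₃CoPH F N θ hP).βfun) (hγβ : θ.γ ^ 2 * β' < 1) (hγ : 0 < θ.γ)
    (ht : (datumOfRecord₁₃CoPH F N θ hP).Tuned θ.γ gIR g₀) (os : List (ULoop F)) (k : ℕ) :
    ∃ (g : ℕ → ℕ → ℝ) (bsel : (ℕ → ℝ) → ℝ),
      (∀ K, RGEqH K (datumOfRecord₁₃CoPH F N θ hP).βfun (g K)) ∧ (∀ K, g K K = gIR) ∧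
      (∀ K i, i ≤ K → 0 < g K i ∧ g K i ≤ (rateCarriersOfRecord₁₃CoPH 𝔯 F θ hP g₀ os k).u3.γ) ∧
      (∀ K, g K ∈ (rateCarriersOfRecord₁₃CoPH 𝔯 F θ hP g₀ os k).u3.W) ∧
      (∀ K, (fun i => g (K + 1) (i + 1)) ∈ (rateCarriersOfRecord₁₃CoPH 𝔯 F θ hP g₀ os k).u3.W) ∧
      (∀ s ∈ (rateCarriersOfRecord₁₃CoPH 𝔯 F θ hP g₀ os k).u3.W,
        0 < bsel s ∧ bsel s ≤ (rateCarriersOfRecord₁₃CoPH 𝔯 F θ hP g₀ os k).u3.γ) ∧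
      (∀ K j, j ≤ K → 1 / g K j ^ 2 ≤ 1 / gIR ^ 2 + max β' 0 * ((K : ℝ) - j)) ∧
      0 < gIR ∧ gIR ≤ θ.γ ∧ (∀ K i, i ≤ K → g K i = runFlow (datumOfRecord₁₃CoPH F N θ hP) g₀ K i) :=
  runLetters_rateCarriersOfRecord₁₃CoPH_of_tuned 𝔯 θ hP hhi hγβ hγ ht le_rfl os k

/-- **UNDER THE CRUX's PREFIX** [bookkeeping]: with the printed-type upper bound on ONE box `]0, γᵤ]` (`γᵤ²β′ < 1`) at an admissible tuple, the (v′-17)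
run letters at the ₁₃ record bundle exist for ALL SMALL COUPLINGS — every `γ ≤ min γᵤ θ.γ`, every `gIR`, every bare sequence tuned to `gIR` within `]0, γ]`,
every `os`, `k` (`ForSmallCouplings` BY NAME, threshold `γ₀ := min γᵤ θ.γ`, `g`-threshold idle).  (B) and `EndpointExistence` are not used. -/
theorem forSmallCouplings_runLetters_datumOfRecord₁₃CoPH (hθ : θ.Admissible F N) {β' γu : ℝ} (hγu : 0 < γu)
    (hhi : BetaUpperH β' γu (datumOfRecord₁₃CoPH F N θ hP).βfun) (hγβ : γu ^ 2 * β' < 1) :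
    ForSmallCouplings (datumOfRecord₁₃CoPH F N θ hP) fun g₀ => ∀ (os : List (ULoop F)) (k : ℕ),
      ∃ (g : ℕ → ℕ → ℝ) (gIR : ℝ) (bsel : (ℕ → ℝ) → ℝ),
        (∀ K, RGEqH K (datumOfRecord₁₃CoPH F N θ hP).βfun (g K)) ∧ (∀ K, g K K = gIR) ∧
        (∀ K i, i ≤ K → 0 < g K i ∧ g K i ≤ (rateCarriersOfRecord₁₃CoPH 𝔯 F θ hP g₀ os k).u3.γ) ∧
        (∀ K, g K ∈ (rateCarriersOfRecord₁₃CoPH 𝔯 F θ hP g₀ os k).u3.W) ∧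
        (∀ K, (fun i => g (K + 1) (i + 1)) ∈ (rateCarriersOfRecord₁₃CoPH 𝔯 F θ hP g₀ os k).u3.W) ∧
        (∀ s ∈ (rateCarriersOfRecord₁₃CoPH 𝔯 F θ hP g₀ os k).u3.W,
          0 < bsel s ∧ bsel s ≤ (rateCarriersOfRecord₁₃CoPH 𝔯 F θ hP g₀ os k).u3.γ) ∧
        (∀ K j, j ≤ K → 1 / g K j ^ 2 ≤ 1 / gIR ^ 2 + max β' 0 * ((K : ℝ) - j)) ∧
        0 < gIR ∧ (∀ K i, i ≤ K → g K i = runFlow (datumOfRecord₁₃CoPH F N θ hP) g₀ K i) := by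
  have hθγ : 0 < θ.γ := hθ.toStage9.gamma_pos
  refine ⟨min γu θ.γ, lt_min hγu hθγ, fun γ hγ hγle => ⟨1, one_pos, fun gIR _ _ g₀ ht os k => ?_⟩⟩
  have hhi' : BetaUpperH β' γ (datumOfRecord₁₃CoPH F N θ hP).βfun := fun j v hv =>
    hhi j v (FlowStep.box_mono (hγle.trans (min_le_left _ _)) j hv)
  have hγβ' : γ ^ 2 * β' < 1 := by
    rcases le_or_gt β' 0 with hb | hb
    · exact lt_of_le_of_lt (mul_nonpos_of_nonneg_of_nonpos (sq_nonneg γ) hb) one_pos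
    · exact lt_of_le_of_lt
        (mul_le_mul_of_nonneg_right (pow_le_pow_left₀ hγ.le (hγle.trans (min_le_left _ _)) 2) hb.le) hγβ
  obtain ⟨g, bsel, h1, h2, h3, h4, h5, h6, hup, h7, -, h9⟩ :=
    runLetters_rateCarriersOfRecord₁₃CoPH_of_tuned 𝔯 θ hP hhi' hγβ' hγ ht (hγle.trans (min_le_right _ _)) os k
  exact ⟨g, gIR, bsel, h1, h2, h3, h4, h5, h6, hup, h7, h9⟩

end AtRecord

/-! ## §3 The (v′-16) block-factor letters at the record -/

section Ne3

variable (𝔯 : RateReading₁₃CoPH N) (θ : Stage13HParams F N) (hP : θ.Provisos₁₃CoPH F N) (g₀ : ℕ → ℝ) (os : List (ULoop F)) (k : ℕ)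

/-- `2 ≤ R.ne3.L` at the record bundle: the block factor IS the family's (`Node00.two_le_ne3LOfRecord₁₁`). [bookkeeping] -/
theorem two_le_ne3_L_rateCarriersOfRecord₁₃CoPH : 2 ≤ (rateCarriersOfRecord₁₃CoPH 𝔯 F θ hP g₀ os k).ne3.L :=
  Node00.two_le_ne3LOfRecord₁₁ F

/-- A positive sixth root of `(R.ne3.L)⁻¹` at the record bundle (NE7 route-#1's rate letter `θ`, `θ⁶ = L⁻¹`): `θ := ((L : ℝ)⁻¹)^{1∕6}`. [folklore] -/
theorem exists_theta6_rateCarriersOfRecord₁₃CoPH :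
    ∃ ϑ : ℝ, 0 < ϑ ∧ ϑ ^ 6 = (((rateCarriersOfRecord₁₃CoPH 𝔯 F θ hP g₀ os k).ne3.L : ℝ))⁻¹ := by
  have hL : (0 : ℝ) < ((rateCarriersOfRecord₁₃CoPH 𝔯 F θ hP g₀ os k).ne3.L : ℝ) := by
    have h2 := two_le_ne3_L_rateCarriersOfRecord₁₃CoPH 𝔯 θ hP g₀ os k
    exact_mod_cast (by omega : 0 < (rateCarriersOfRecord₁₃CoPH 𝔯 F θ hP g₀ os k).ne3.L)
  have hinv : 0 < (((rateCarriersOfRecord₁₃CoPH 𝔯 F θ hP g₀ os k).ne3.L : ℝ))⁻¹ := inv_pos.mpr hL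
  refine ⟨((((rateCarriersOfRecord₁₃CoPH 𝔯 F θ hP g₀ os k).ne3.L : ℝ))⁻¹) ^ ((1 : ℝ) / 6), Real.rpow_pos_of_pos hinv _, ?_⟩
  rw [← Real.rpow_natCast, ← Real.rpow_mul hinv.le]
  norm_num

/-- **THE (v′-16) BLOCK-FACTOR LETTERS AT THE RECORD** — `2 ≤ R.ne3.L` and a positive `θ` with `θ ^ 6 = (R.ne3.L)⁻¹`, jointly. [bookkeeping] -/
theorem ne3Letters_rateCarriersOfRecord₁₃CoPH :
    2 ≤ (rateCarriersOfRecord₁₃CoPH 𝔯 F θ hP g₀ os k).ne3.L ∧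
      ∃ ϑ : ℝ, 0 < ϑ ∧ ϑ ^ 6 = (((rateCarriersOfRecord₁₃CoPH 𝔯 F θ hP g₀ os k).ne3.L : ℝ))⁻¹ :=
  ⟨two_le_ne3_L_rateCarriersOfRecord₁₃CoPH 𝔯 θ hP g₀ os k, exists_theta6_rateCarriersOfRecord₁₃CoPH 𝔯 θ hP g₀ os k⟩

end Ne3

/-! ## §4 The letter signs from the (D4) read-out binders -/

/-- **THE LETTER SIGNS FROM (D4)** [bookkeeping]: the β-read-out binders `ReadOutAt D u` carry `0 ≤ u.θ`, `0 ≤ u.C₅`, `0 ≤ u.ω` (the three signs `hlink`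
displays before clause (v′-17)) together with `0 ≤ u.cr`, `u.θ ≤ u.ρ`, `u.ω ≤ u.ρ` (projection of the last six conjuncts). -/
theorem signs_of_readOutAt {D : Datum F N} {u : U3Carriers} (h : ReadOutAt D u) :
    (0 ≤ u.θ ∧ 0 ≤ u.C₅ ∧ 0 ≤ u.ω) ∧ 0 ≤ u.cr ∧ u.θ ≤ u.ρ ∧ u.ω ≤ u.ρ := by
  obtain ⟨_, _, _, _, -, -, -, -, -, -, -, hcr, hC₅, hθ, hω, hθρ, hωρ⟩ := h
  exact ⟨⟨hθ, hC₅, hω⟩, hcr, hθρ, hωρ⟩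

/-- … at the ₁₃ record bundle on the datum of record (the `ReadOutAt` conjunct of K3⁷ v2's `PHolderD4`, read at `R.u3`). [bookkeeping] -/
theorem signs_rateCarriersOfRecord₁₃CoPH_of_readOutAt (𝔯 : RateReading₁₃CoPH N) (θ : Stage13HParams F N) (hP : θ.Provisos₁₃CoPH F N)
    (g₀ : ℕ → ℝ) (os : List (ULoop F)) (k : ℕ)
    (h : ReadOutAt (datumOfRecord₁₃CoPH F N θ hP) (rateCarriersOfRecord₁₃CoPH 𝔯 F θ hP g₀ os k).u3) :
    0 ≤ (rateCarriersOfRecord₁₃CoPH 𝔯 F θ hP g₀ os k).u3.θ ∧ 0 ≤ (rateCarriersOfRecord₁₃CoPH 𝔯 F θ hP g₀ os k).u3.C₅ ∧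
      0 ≤ (rateCarriersOfRecord₁₃CoPH 𝔯 F θ hP g₀ os k).u3.ω :=
  (signs_of_readOutAt h).1

/-! ## §5 The bracket (T)'s window clause from the displayed `γ² ≤ e⁻¹` -/

/-- Every member of `Window γ` has positive entries with square `≤ e⁻¹` as soon as `γ² ≤ e⁻¹`. [folklore] -/
theorem window_sq_le_exp_neg_one {γ : ℝ} (hγ : γ ^ 2 ≤ Real.exp (-1)) :
    ∀ s ∈ Window γ, ∀ j : ℕ, 0 < s j ∧ s j ^ 2 ≤ Real.exp (-1) := fun _ hs j =>
  ⟨(hs j).1, (pow_le_pow_left₀ (hs j).1.le (hs j).2 2).trans hγ⟩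

/-- … at the ₁₃ record bundle: (T)'s window clause `∀ s ∈ R.u3.W, ∀ j, 0 < s j ∧ s j ^ 2 ≤ e⁻¹` from the DISPLAYED `θ.γ ^ 2 ≤ e⁻¹`
(admissibility alone gives `0 < θ.γ < 1`). [bookkeeping] -/
theorem window_rateCarriersOfRecord₁₃CoPH_sq_le_exp_neg_one (𝔯 : RateReading₁₃CoPH N) (θ : Stage13HParams F N) (hP : θ.Provisos₁₃CoPH F N)
    (g₀ : ℕ → ℝ) (os : List (ULoop F)) (k : ℕ) (hγ : θ.γ ^ 2 ≤ Real.exp (-1)) :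
    ∀ s ∈ (rateCarriersOfRecord₁₃CoPH 𝔯 F θ hP g₀ os k).u3.W, ∀ j : ℕ, 0 < s j ∧ s j ^ 2 ≤ Real.exp (-1) :=
  window_sq_le_exp_neg_one hγ

/-! ## §6 The radius sign at an admissible tuple -/

/-- `0 < R.u3.γ` at the record bundle of an ADMISSIBLE Stage-13 tuple (`R.u3.γ = θ.γ`, `Stage9Params.Admissible.gamma_pos`). [bookkeeping] -/
theorem gamma_pos_rateCarriersOfRecord₁₃CoPH (𝔯 : RateReading₁₃CoPH N) (θ : Stage13HParams F N) (hP : θ.Provisos₁₃CoPH F N)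
    (hθ : θ.Admissible F N) (g₀ : ℕ → ℝ) (os : List (ULoop F)) (k : ℕ) :
    0 < (rateCarriersOfRecord₁₃CoPH 𝔯 F θ hP g₀ os k).u3.γ :=
  hθ.toStage9.gamma_pos

/-! ## §7 (v1.1, APPEND-ONLY) The (ii-m) identification's FAMILY LATTICE LETTERS -/

/-- The top (unit-lattice) level of the `n`-th approximation of the family has `(2L^m)⁴` sites: `Site (F.P n) n` is the torus `T^{(n)}` with `2·L^{m+n−n}`
sites per direction in `d = 4` directions (`Site.card_site`). [folklore] -/
theorem card_site_top_family (F : T4Family) (n : ℕ) : Fintype.card (Site (F.P n) n) = (2 * F.L ^ F.m) ^ 4 := by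
  rw [Site.card_site]
  show (2 * F.L ^ (F.m + n - n)) ^ 4 = (2 * F.L ^ F.m) ^ 4
  rw [Nat.add_sub_cancel]

/-- … in the reals: `|T^{(n)}_1| = ℓ⁴` with `ℓ = F.side = 2L^m` the side of the physical torus — the SAME number for every `n`. [folklore] -/
theorem card_site_top_family_real (F : T4Family) (n : ℕ) : (Fintype.card (Site (F.P n) n) : ℝ) = F.side ^ 4 := by
  rw [card_site_top_family, T4Family.side]
  push_cast
  ring

/-- **THE (ii-m) FAMILY LATTICE LETTERS** [bookkeeping]: with `Pf := fun K => F.P (Koff + K)`, `d₀ := 4`, `L₀ := F.L` the first four conjuncts of the reference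
ledger's lattice identification in `hlink` — constant dimension, constant block size, `(Pf K).K = Koff + K`, and a `K`-FREE unit-lattice site count — hold with
the site count `F.side ^ 4`; so the clause `(Fintype.card (Site (Pf K) (Pf K).K) : ℝ) = S.vol` is met exactly when the spine reading's volume letter IS `F.side ^ 4`
(a displayed constraint on `cr`, not inhabited here), and the decay-threshold letter then reads `kappa₀ (4 * 2 ^ 4) (2 * 4) ≤ R.u3.κ` (residual `κ` of `𝔯.lit`).
The `cells`-clauses against NODE O's reference ledger `L.All` are NOT touched. -/
theorem latticeLetters_family (F : T4Family) (Koff : ℕ) :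
    (∀ K, (F.P (Koff + K)).d = 4) ∧ (∀ K, (F.P (Koff + K)).L = F.L) ∧ (∀ K, (F.P (Koff + K)).K = Koff + K) ∧
      (∀ K, (Fintype.card (Site (F.P (Koff + K)) (F.P (Koff + K)).K) : ℝ) = F.side ^ 4) :=
  ⟨fun _ => rfl, fun _ => rfl, fun _ => rfl, fun K => card_site_top_family_real F (Koff + K)⟩

/-- … read against a spine-carrier volume letter: if `vol = F.side ^ 4` then the four family clauses of (ii-m) hold with `S.vol` in place LITERALLY. [bookkeeping] -/
theorem latticeLetters_family_of_vol_eq (F : T4Family) (Koff : ℕ) {vol : ℝ} (hvol : vol = F.side ^ 4) :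
    (∀ K, (F.P (Koff + K)).d = 4) ∧ (∀ K, (F.P (Koff + K)).L = F.L) ∧ (∀ K, (F.P (Koff + K)).K = Koff + K) ∧
      (∀ K, (Fintype.card (Site (F.P (Koff + K)) (F.P (Koff + K)).K) : ℝ) = vol) := by
  subst hvol
  exact latticeLetters_family F Koff

/-! ## §8 (v1.2, APPEND-ONLY) LOCATED: (ii-m)'s site-count clause EXCLUDES a unit volume letter `S.vol = 1` — for EVERY lattice `Pf` -/

/-- Every torus level of every `Params` has at least two sites: `|T^{(j)}| = (2·L^{m+K−j})^d ≥ 2` (`d ≥ 1`, `L ≥ 1`; `Site.card_site`). [folklore] -/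
theorem two_le_card_site (P : Params) (j : ℕ) : 2 ≤ Fintype.card (Site P j) := by
  rw [Site.card_site]
  have hs : 2 ≤ P.sitesPerDir j := by
    unfold Params.sitesPerDir
    have : 1 ≤ P.L ^ (P.m + P.K - j) := Nat.one_le_pow _ _ P.L_pos
    omega
  calc 2 ≤ P.sitesPerDir j := hs
    _ = P.sitesPerDir j ^ 1 := (pow_one _).symm
    _ ≤ P.sitesPerDir j ^ P.d := Nat.pow_le_pow_right (by omega) P.hd

/-- … so NO top lattice has site count `1` (in the reals, as `hlink` reads it). [folklore] -/
theorem card_site_top_ne_one (P : Params) : (Fintype.card (Site P P.K) : ℝ) ≠ 1 := by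
  have h := two_le_card_site P P.K
  have h' : (2 : ℝ) ≤ (Fintype.card (Site P P.K) : ℝ) := by exact_mod_cast h
  linarith

/-- **LOCATED (A6-type, kernel form): a spine reading with the volume letter `S.vol = 1` makes (ii-m)'s site-count clause of `hlink` UNSATISFIABLE FOR EVERY lattice
identification `Pf`** — `¬ ∀ K, (Fintype.card (Site (Pf K) (Pf K).K) : ℝ) = S.vol` once `S.vol = 1` (indeed it fails at EVERY `K`).  Hence F's `hlink` (p583345) displayed at a reading
whose `vol` is the «free normalisation» `1` (dag-n20-d's `crOfRecord₁₃At` draft, pub-ymgap INBOX l.24693; design point dag-n19-d l.25098 ∕ this seat's §7) has NO inhabitant, and any theorem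
taking it as a hypothesis at that reading is vacuous as typed (№189 A6 rule) — the repair is the reading's: `vol := F.side ^ 4` (= `|T^{(n)}_1|` for every `n`, `card_site_top_family_real`),
under which §7's `latticeLetters_family_of_vol_eq` inhabits the four family clauses.  Count-neutral; a typing fact about a letter, no estimate. [bookkeeping] -/
theorem not_siteCount_clause_of_vol_eq_one {vol : ℝ} (hvol : vol = 1) (Pf : ℕ → Params) :
    ¬ ∀ K : ℕ, (Fintype.card (Site (Pf K) (Pf K).K) : ℝ) = vol := by
  intro h
  exact card_site_top_ne_one (Pf 0) (hvol ▸ h 0)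

/-- … and the clause fails at EVERY single `K`, not only somewhere. [bookkeeping] -/
theorem siteCount_ne_of_vol_eq_one {vol : ℝ} (hvol : vol = 1) (Pf : ℕ → Params) (K : ℕ) :
    (Fintype.card (Site (Pf K) (Pf K).K) : ℝ) ≠ vol := by
  rw [hvol]
  exact card_site_top_ne_one (Pf K)

/-- **THE CONVERSE OF §7's `latticeLetters_family_of_vol_eq`** (ref-O READ-20 NIT-1, «exactly when» now typed in both directions): if the family lattices `Pf := fun K => F.P (Koff + K)`
meet (ii-m)'s site-count clause with the volume letter `vol`, then `vol = F.side ^ 4` (read at `K = 0`; `card_site_top_family_real`). [bookkeeping] -/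
theorem vol_eq_of_siteCount_family (F : T4Family) (Koff : ℕ) {vol : ℝ}
    (h : ∀ K, (Fintype.card (Site (F.P (Koff + K)) (F.P (Koff + K)).K) : ℝ) = vol) : vol = F.side ^ 4 := by
  rw [← h 0]
  exact card_site_top_family_real F (Koff + 0)

/-- … so for the family lattices the clause holds IFF `vol = F.side ^ 4`. [bookkeeping] -/
theorem siteCount_family_iff_vol_eq (F : T4Family) (Koff : ℕ) (vol : ℝ) :
    (∀ K, (Fintype.card (Site (F.P (Koff + K)) (F.P (Koff + K)).K) : ℝ) = vol) ↔ vol = F.side ^ 4 :=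
  ⟨vol_eq_of_siteCount_family F Koff, fun hvol => (latticeLetters_family_of_vol_eq F Koff hvol).2.2.2⟩

end Summit.QuantumFields.YangMills.BalabanUVNodes.N19RateEdgeRecordRunLetters

end
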